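import Summits.QuantumFields.BalabanUV.Beta.GAN24.CubicSlotChargeOfLocal
import Summits.QuantumFields.BalabanUV.Beta.GAN24.CombThreeFaceRec

/-!
# `BalabanUV.Beta.GAN24.CombSpureSlotCharges` — binder row G-an2-4 ∕ (CONV-C), TRANSFER-III, the (III′) (C)-campaign's supplier `hB0` AT LEVELS `≥ 1`: **«S3C-REC» AT THE COMB DATA** —
# at an1's record `symTablesAn1S2 d Lc cΛt` (`Lc` odd, `3 ≤ Lc`, centred root), for ALL pins `cE cVH cΛ`, EVERY member `j`, all units `s_f s_m`, every slot `(κ, s)` and field pair `(a, b)`: the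
# THREE two-constant-leg ff contractions of the unit-changed comb pure table `unitS s_f s_m (SpureCombOf tabs cE cVH cΛ j)` — slot fixed ∕ both legs summed; slot + first leg summed; slot +
# second leg summed — are `HasSum … 0`.  The comb twin of leaf-04 g63's `ThreeFaceRecClosed.hasSum_unitS_SpureRecAt` («S3C-REC» every member): member `j+1` by the member-generic slot charge
# `CubicSlotChargeOfLocal.hasSum_legs_unitS_e3OfK_of_local` on M.43's bm reading (member `𝒯 S̃comb_j`) and «3F-REC» at the comb (`CombThreeFaceRec.threeFace_transport_ScombOf_rec`); clauses
# (ii)(iii) by full translation covariance of the ff block; member `0` = `cE·wilsonA` on the ff block (leaf-04's `SourceBracketCombOfS3c.hasSum_unitS_SpureRecAt_zero`).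
# (G-an2-4 CRUX TEAM (2), leaf prover `b2b-balaban-gan24-formalise-leaf-01`, gen 87; the «slot + second-leg constant sums of `SpureCombOf` vanish» socket of README-g86 ∕ the OWNER's memo M-2 §1)

NOT IN PRINT; OUR BOOKKEEPING ([folklore] BY NAME; 0 `def`, 0 cited fact, 0 `def … : Prop`, 0 sorry).
HONEST FRAMING (cell contract, verbatim): «discharging `BetaPertH` makes Bałaban's UV stability UNCONDITIONAL — a real constructive-QFT result; it is NOT the continuum limit and NOT
the Clay problem.»  HONEST DEPENDENCY (verbatim): «continuum YM on T⁴ ⇐ BetaPertH ∧ nine spine estimates (0/9 proved); BetaPertH ⇐ (D1) ∧ (D4) ∧ CAP+tail; G-an2-4 gates asym, D1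
and NE2/3/4.»

## What is proved (generic `d`, `[NeZero Lc]`, an1's record)
* §1 `unitS_SpureCombOf_succ_inl_inl` (the ff block of member `j+1` = that of the bm-read E-sector over `𝒯 S̃comb_j`), `unitS_SpureCombOf_zero_inl_inl` (member `0` = `cE·wilsonA`),
  `unitS_SpureCombOf_succ_inl_inl_shift` (full translation covariance of the ff block).
* §2 **`hasSum_legs_unitS_SpureCombOf_succ`** (clause (i), `Lc` odd, `3 ≤ Lc`), **`hasSum_slot_leg_unitS_SpureCombOf_succ`** (ii), **`hasSum_slot_leg'_unitS_SpureCombOf_succ`** (iii).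
* §3 **`hasSum_unitS_SpureCombOf`** — «S3C-REC» AT THE COMB, EVERY MEMBER.
WHAT THIS IS NOT: NOT (Z)_comb (needs also the face-slot split `hsplit` on the comb member); NOT `hB0`; NEVER «G-an2-4 closed» as (CONV-C); NOT D1, NOT `BetaPertH`, NOT continuum, NOT Clay.
2026-08-27; no existing file touched.
-/

noncomputable section

open Finset
open scoped BigOperators
open Literature.MathematicalPhysics.QuantumFieldTheory
open Literature.MathematicalPhysics.QuantumFieldTheory.Balaban1983to89
open Literature.MathematicalPhysics.QuantumFieldTheory.Balaban1983to89.Beta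
open ExpKernelCalculus (Site MKer comp shiftK)
open AffineAveraging (box toSite)
open AveragingContoursRooted (ctr ctrOff ctrOff_mem_box)
open OneStepResolventKernel (Fib LocStencil)
open OneStepKernelFamily (KInvStep)
open StepJetData (wilsonA)
open BalabanStepJetsSucc (wE wVH)
open Summit.QuantumFields.BalabanUV.Beta.TameKernelCalculus (trK)
open Summit.QuantumFields.BalabanUV.Beta.BorderedHessian (stepScale)
open Summit.QuantumFields.BalabanUV.Beta.AxialDressingRooted (coDressKBmAt shiftK_coDressKBmAt_KInvStep)
open Summit.QuantumFields.BalabanUV.Beta.HessKerDressedUnits (unitS)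
open Summit.QuantumFields.BalabanUV.Beta.SpineRooted (e3OfK e3OfK_translate SpureRecAt SpureRecOf_zero_level)
open Summit.QuantumFields.BalabanUV.Beta.SymAveragingHessianCounts (symVhSAt symVhSAt_inl_inl)
open Summit.QuantumFields.BalabanUV.Beta.SymSecondOrderTablesAn1 (symTablesAn1S2 symTablesAn1S2_V)
open Summit.QuantumFields.BalabanUV.Beta.CombChartStepJets (ScombOf SpureCombOf SpureCombOf_eq locStencil_ScombOf)
open Summit.QuantumFields.BalabanUV.Beta.SymCorrectorKernel (psiKS)
open Summit.QuantumFields.BalabanUV.Beta.SymCorrectorFace (slotPsiS)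
open Summit.QuantumFields.BalabanUV.Beta.GAN24.CombCubicStepTransport (SpureCombOf_succ_eq_bm_transport)
open Summit.QuantumFields.BalabanUV.Beta.GAN24.CombTransportedBorder (pos_Lc)
open Summit.QuantumFields.BalabanUV.Beta.GAN24.CombVHEWordsZeroStep (exists_locStencil_transport_ScombOf transport_ScombOf_translate)
open Summit.QuantumFields.BalabanUV.Beta.GAN24.WilsonVertexTwoConst (unitS_inl_inl)
open Summit.QuantumFields.BalabanUV.Beta.GAN24.SourceBracketCombOfS3c (unitS_SpureRecAt_zero_inl_inl hasSum_unitS_SpureRecAt_zero)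
open Summit.QuantumFields.BalabanUV.Beta.GAN24.CubicSlotChargeOfLocal (hasSum_legs_unitS_e3OfK_of_local)
open Summit.QuantumFields.BalabanUV.Beta.GAN24.CombThreeFaceRec (threeFace_transport_ScombOf_rec)

namespace Summit.QuantumFields.BalabanUV.Beta.GAN24.CombSpureSlotCharges

variable {d : ℕ} {Lc : ℕ} [NeZero Lc]

/-! ## §1 The ff block of the comb pure table -/

/-- [folklore] **THE ff BLOCK OF `unitS (S̃′comb_{j+1})` IS THAT OF THE bm-READ E-SECTOR OVER `𝒯 S̃comb_j`** (M.43; the border has no ff block at an1's record). -/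
theorem unitS_SpureCombOf_succ_inl_inl (cΛt sf sm cE cVH cΛ : ℝ) (j : ℕ) (κ : Fin (d + 1)) (u x z : Site (d + 1)) (α β : Fin (d + 1)) :
    unitS sf sm (SpureCombOf (symTablesAn1S2 d Lc cΛt) cE cVH cΛ (j + 1)) κ u x z (Sum.inl α) (Sum.inl β)
      = unitS sf sm (fun κ t => (cE * wE d Lc (j + 1)) • e3OfK Lc (coDressKBmAt (ctr (d + 1) Lc) Lc (KInvStep (d := d) Lc j))
          (fun κ u => comp (comp (trK (psiKS (ctrOff (d + 1) Lc) Lc)) (slotPsiS (ctrOff (d + 1) Lc) Lc (ScombOf (symTablesAn1S2 d Lc cΛt) cE cVH cΛ j) κ u))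
            (psiKS (ctrOff (d + 1) Lc) Lc)) κ t) κ u x z (Sum.inl α) (Sum.inl β) := by
  rw [unitS_inl_inl, unitS_inl_inl, SpureCombOf_succ_eq_bm_transport]
  simp only [Pi.add_apply, Pi.smul_apply, smul_eq_mul, symTablesAn1S2_V, symVhSAt_inl_inl, mul_zero, add_zero]

/-- [folklore] **MEMBER `0`: THE ff BLOCK OF `unitS (S̃′comb_0)` IS `cE·wilsonA`'s**, i.e. that of an2's `unitS (SpureRecAt … 0)` (any root). -/
theorem unitS_SpureCombOf_zero_inl_inl (cΛt sf sm cE cVH cΛ : ℝ) (κ : Fin (d + 1)) (u x z : Site (d + 1)) (α β : Fin (d + 1)) :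
    unitS sf sm (SpureCombOf (symTablesAn1S2 d Lc cΛt) cE cVH cΛ 0) κ u x z (Sum.inl α) (Sum.inl β)
      = unitS sf sm (SpureRecAt d Lc (ctr (d + 1) Lc) cE cVH cΛ 0) κ u x z (Sum.inl α) (Sum.inl β) := by
  rw [unitS_SpureRecAt_zero_inl_inl, unitS_inl_inl, SpureCombOf_eq, SpureRecOf_zero_level]
  simp only [Pi.add_apply, Pi.smul_apply, smul_eq_mul, symTablesAn1S2_V, symVhSAt_inl_inl, mul_zero, add_zero]
  ring

/-- [folklore] **FULL TRANSLATION COVARIANCE OF THE ff BLOCK OF MEMBER `j+1`**: `unitS (S̃′comb_{j+1}) κ u x z (inl α)(inl β) = unitS (S̃′comb_{j+1}) κ 0 (x − u) (z − u) (inl α)(inl β)`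
(the E-sector over the block-covariant member `𝒯 S̃comb_j` is covariant under all coarse translations — an2's `e3OfK_translate`). -/
theorem unitS_SpureCombOf_succ_inl_inl_shift (cΛt sf sm cE cVH cΛ : ℝ) (j : ℕ) (κ : Fin (d + 1)) (u x z : Site (d + 1)) (α β : Fin (d + 1)) :
    unitS sf sm (SpureCombOf (symTablesAn1S2 d Lc cΛt) cE cVH cΛ (j + 1)) κ u x z (Sum.inl α) (Sum.inl β)
      = unitS sf sm (SpureCombOf (symTablesAn1S2 d Lc cΛt) cE cVH cΛ (j + 1)) κ 0 (x - u) (z - u) (Sum.inl α) (Sum.inl β) := by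
  have hGs : ∀ t : Site (d + 1), shiftK (-((Lc : ℤ) • t)) (coDressKBmAt (ctr (d + 1) Lc) Lc (KInvStep (d := d) Lc j))
      = coDressKBmAt (ctr (d + 1) Lc) Lc (KInvStep (d := d) Lc j) := fun t => shiftK_coDressKBmAt_KInvStep (d := d) (ctr (d + 1) Lc) j t
  have h := e3OfK_translate (N := Lc) hGs
    (S := fun κ u => comp (comp (trK (psiKS (ctrOff (d + 1) Lc) Lc)) (slotPsiS (ctrOff (d + 1) Lc) Lc (ScombOf (symTablesAn1S2 d Lc cΛt) cE cVH cΛ j) κ u))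
      (psiKS (ctrOff (d + 1) Lc) Lc))
    (fun κ u t => transport_ScombOf_translate (d := d) (Lc := Lc) cΛt cE cVH cΛ j κ u t) κ 0 u
  rw [zero_add] at h
  rw [unitS_SpureCombOf_succ_inl_inl, unitS_SpureCombOf_succ_inl_inl, unitS_inl_inl, unitS_inl_inl]
  simp only [Pi.smul_apply, smul_eq_mul]
  rw [h]
  simp only [shiftK, sub_eq_add_neg]

/-! ## §2 Member `j+1`: the three clauses -/

/-- NOT IN PRINT; OUR BOOKKEEPING ([folklore]; **CLAUSE (i) AT THE COMB**).  At an1's record with `Lc` odd and `3 ≤ Lc`, all pins and units, every `j`, slot `(κ″, u″)`, field pair `(α, β)`: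
`Σ_{(x,z)} unitS s_f s_m (S̃′comb_{j+1}) κ″ u″ x z (inl α)(inl β) = 0` — the member-generic slot charge on `𝒯 S̃comb_j` is a multiple of its period-`Lc` three-face form, which vanishes by
«3F-REC» at the comb. -/
theorem hasSum_legs_unitS_SpureCombOf_succ (hLo : Odd Lc) (hLc3 : 3 ≤ Lc) (cΛt sf sm cE cVH cΛ : ℝ) (j : ℕ) (κ'' : Fin (d + 1)) (u'' : Site (d + 1)) (α β : Fin (d + 1)) :
    HasSum (fun p : Site (d + 1) × Site (d + 1) =>
      unitS sf sm (SpureCombOf (symTablesAn1S2 d Lc cΛt) cE cVH cΛ (j + 1)) κ'' u'' p.1 p.2 (Sum.inl α) (Sum.inl β)) 0 := by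
  have hLc : 1 ≤ Lc := Nat.one_le_iff_ne_zero.mpr (NeZero.ne Lc)
  obtain ⟨CM, δM, hδM, hM⟩ := exists_locStencil_transport_ScombOf (d := d) (Lc := Lc) cΛt cE cVH cΛ j
  have h := hasSum_legs_unitS_e3OfK_of_local (d := d) (Lc := Lc) hLc (ctrOff_mem_box (pos_Lc (Lc := Lc))) hM hδM
    (fun κ u t => transport_ScombOf_translate (d := d) (Lc := Lc) cΛt cE cVH cΛ j κ u t) sf sm (cE * wE d Lc (j + 1)) j κ'' u'' α β
  have h3F := threeFace_transport_ScombOf_rec (d := d) hLo hLc3 cΛt cE cVH cΛ j 0 κ'' α β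
  simp only [zero_add, pow_one] at h3F
  rw [h3F, mul_zero] at h
  -- the comb root `ctr (d+1) Lc` is `toSite (ctrOff (d+1) Lc)` (`rfl`): re-spell the E-sector's kernel
  have h' : HasSum (fun p : Site (d + 1) × Site (d + 1) =>
      unitS sf sm (fun κ t => (cE * wE d Lc (j + 1)) • e3OfK Lc (coDressKBmAt (ctr (d + 1) Lc) Lc (KInvStep (d := d) Lc j))
        (fun κ u => comp (comp (trK (psiKS (ctrOff (d + 1) Lc) Lc)) (slotPsiS (ctrOff (d + 1) Lc) Lc (ScombOf (symTablesAn1S2 d Lc cΛt) cE cVH cΛ j) κ u))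
          (psiKS (ctrOff (d + 1) Lc) Lc)) κ t) κ'' u'' p.1 p.2 (Sum.inl α) (Sum.inl β)) 0 := h
  refine h'.congr_fun fun p => ?_
  exact unitS_SpureCombOf_succ_inl_inl (d := d) (Lc := Lc) cΛt sf sm cE cVH cΛ j κ'' u'' p.1 p.2 α β

/-- NOT IN PRINT; OUR BOOKKEEPING ([folklore]; **CLAUSE (ii) AT THE COMB** — slot and first leg summed, second leg fixed at `s`): re-indexing `(u, x) ↦ (x − u, s − u)` onto clause (i). -/
theorem hasSum_slot_leg_unitS_SpureCombOf_succ (hLo : Odd Lc) (hLc3 : 3 ≤ Lc) (cΛt sf sm cE cVH cΛ : ℝ) (j : ℕ) (κ'' : Fin (d + 1)) (α β : Fin (d + 1))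
    (s : Site (d + 1)) :
    HasSum (fun p : Site (d + 1) × Site (d + 1) =>
      unitS sf sm (SpureCombOf (symTablesAn1S2 d Lc cΛt) cE cVH cΛ (j + 1)) κ'' p.1 p.2 s (Sum.inl α) (Sum.inl β)) 0 := by
  have hi := hasSum_legs_unitS_SpureCombOf_succ (d := d) hLo hLc3 cΛt sf sm cE cVH cΛ j κ'' 0 α β
  have hfun : (fun p : Site (d + 1) × Site (d + 1) =>
        unitS sf sm (SpureCombOf (symTablesAn1S2 d Lc cΛt) cE cVH cΛ (j + 1)) κ'' p.1 p.2 s (Sum.inl α) (Sum.inl β))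
      = (fun q : Site (d + 1) × Site (d + 1) => unitS sf sm (SpureCombOf (symTablesAn1S2 d Lc cΛt) cE cVH cΛ (j + 1)) κ'' 0 q.1 q.2 (Sum.inl α) (Sum.inl β))
        ∘ ⇑((Equiv.prodShear (Equiv.subLeft s) (fun u : Site (d + 1) => Equiv.subRight u)).trans
            (Equiv.prodComm (Site (d + 1)) (Site (d + 1)))) := by
    funext p
    obtain ⟨u, x⟩ := p
    simp only [Function.comp_apply, Equiv.trans_apply, Equiv.prodShear_apply, Equiv.prodComm_apply, Prod.swap_prod_mk,
      Equiv.subLeft_apply, Equiv.subRight_apply]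
    exact unitS_SpureCombOf_succ_inl_inl_shift (d := d) (Lc := Lc) cΛt sf sm cE cVH cΛ j κ'' u x s α β
  rw [hfun]
  exact (Equiv.hasSum_iff _).2 hi

/-- NOT IN PRINT; OUR BOOKKEEPING ([folklore]; **CLAUSE (iii) AT THE COMB** — slot and second leg summed, first leg fixed at `s`): re-indexing `(u, z) ↦ (s − u, z − u)`. -/
theorem hasSum_slot_leg'_unitS_SpureCombOf_succ (hLo : Odd Lc) (hLc3 : 3 ≤ Lc) (cΛt sf sm cE cVH cΛ : ℝ) (j : ℕ) (κ'' : Fin (d + 1)) (α β : Fin (d + 1))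
    (s : Site (d + 1)) :
    HasSum (fun p : Site (d + 1) × Site (d + 1) =>
      unitS sf sm (SpureCombOf (symTablesAn1S2 d Lc cΛt) cE cVH cΛ (j + 1)) κ'' p.1 s p.2 (Sum.inl α) (Sum.inl β)) 0 := by
  have hi := hasSum_legs_unitS_SpureCombOf_succ (d := d) hLo hLc3 cΛt sf sm cE cVH cΛ j κ'' 0 α β
  have hfun : (fun p : Site (d + 1) × Site (d + 1) =>
        unitS sf sm (SpureCombOf (symTablesAn1S2 d Lc cΛt) cE cVH cΛ (j + 1)) κ'' p.1 s p.2 (Sum.inl α) (Sum.inl β))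
      = (fun q : Site (d + 1) × Site (d + 1) => unitS sf sm (SpureCombOf (symTablesAn1S2 d Lc cΛt) cE cVH cΛ (j + 1)) κ'' 0 q.1 q.2 (Sum.inl α) (Sum.inl β))
        ∘ ⇑(Equiv.prodShear (Equiv.subLeft s) (fun u : Site (d + 1) => Equiv.subRight u)) := by
    funext p
    obtain ⟨u, z⟩ := p
    simp only [Function.comp_apply, Equiv.prodShear_apply, Equiv.subLeft_apply, Equiv.subRight_apply]
    exact unitS_SpureCombOf_succ_inl_inl_shift (d := d) (Lc := Lc) cΛt sf sm cE cVH cΛ j κ'' u s z α β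
  rw [hfun]
  exact (Equiv.hasSum_iff _).2 hi

/-! ## §3 «S3C-REC» at the comb, every member -/

/-- [folklore] **MEMBER `0` AT THE COMB**: the three clauses for `unitS (S̃′comb_0)` are those of an2's `unitS (SpureRecAt … 0)` (same ff block, `cE·wilsonA`; leaf-04's
`SourceBracketCombOfS3c.hasSum_unitS_SpureRecAt_zero`). -/
theorem hasSum_unitS_SpureCombOf_zero (cΛt cE cVH cΛ : ℝ) (sf sm : ℝ) (κ a b : Fin (d + 1)) (s : Site (d + 1)) :
    HasSum (fun p : Site (d + 1) × Site (d + 1) =>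
        unitS sf sm (SpureCombOf (symTablesAn1S2 d Lc cΛt) cE cVH cΛ 0) κ s p.1 p.2 (Sum.inl a) (Sum.inl b)) 0 ∧
      HasSum (fun p : Site (d + 1) × Site (d + 1) =>
        unitS sf sm (SpureCombOf (symTablesAn1S2 d Lc cΛt) cE cVH cΛ 0) κ p.1 p.2 s (Sum.inl a) (Sum.inl b)) 0 ∧
      HasSum (fun p : Site (d + 1) × Site (d + 1) =>
        unitS sf sm (SpureCombOf (symTablesAn1S2 d Lc cΛt) cE cVH cΛ 0) κ p.1 s p.2 (Sum.inl a) (Sum.inl b)) 0 := by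
  obtain ⟨h1, h2, h3⟩ := hasSum_unitS_SpureRecAt_zero (d := d) (Lc := Lc) (ctr (d + 1) Lc) sf sm cE cVH cΛ κ a b s
  have e1 : (fun p : Site (d + 1) × Site (d + 1) => unitS sf sm (SpureCombOf (symTablesAn1S2 d Lc cΛt) cE cVH cΛ 0) κ s p.1 p.2 (Sum.inl a) (Sum.inl b))
      = (fun p : Site (d + 1) × Site (d + 1) => unitS sf sm (SpureRecAt d Lc (ctr (d + 1) Lc) cE cVH cΛ 0) κ s p.1 p.2 (Sum.inl a) (Sum.inl b)) :=
    funext fun p => unitS_SpureCombOf_zero_inl_inl (d := d) (Lc := Lc) cΛt sf sm cE cVH cΛ κ s p.1 p.2 a b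
  have e2 : (fun p : Site (d + 1) × Site (d + 1) => unitS sf sm (SpureCombOf (symTablesAn1S2 d Lc cΛt) cE cVH cΛ 0) κ p.1 p.2 s (Sum.inl a) (Sum.inl b))
      = (fun p : Site (d + 1) × Site (d + 1) => unitS sf sm (SpureRecAt d Lc (ctr (d + 1) Lc) cE cVH cΛ 0) κ p.1 p.2 s (Sum.inl a) (Sum.inl b)) :=
    funext fun p => unitS_SpureCombOf_zero_inl_inl (d := d) (Lc := Lc) cΛt sf sm cE cVH cΛ κ p.1 p.2 s a b
  have e3 : (fun p : Site (d + 1) × Site (d + 1) => unitS sf sm (SpureCombOf (symTablesAn1S2 d Lc cΛt) cE cVH cΛ 0) κ p.1 s p.2 (Sum.inl a) (Sum.inl b))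
      = (fun p : Site (d + 1) × Site (d + 1) => unitS sf sm (SpureRecAt d Lc (ctr (d + 1) Lc) cE cVH cΛ 0) κ p.1 s p.2 (Sum.inl a) (Sum.inl b)) :=
    funext fun p => unitS_SpureCombOf_zero_inl_inl (d := d) (Lc := Lc) cΛt sf sm cE cVH cΛ κ p.1 s p.2 a b
  rw [e1, e2, e3]
  exact ⟨h1, h2, h3⟩

/-- NOT IN PRINT; OUR BOOKKEEPING ([folklore]; **«S3C-REC» AT THE COMB DATA, EVERY MEMBER**).  At an1's record with `Lc` odd and `3 ≤ Lc`, for ALL pins `cE cVH cΛ`, EVERY level `j`, all units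
`s_f s_m`, slot `(κ, s)` and field pair `(a, b)`: the three two-constant-leg ff contractions of `unitS s_f s_m (SpureCombOf tabs cE cVH cΛ j)` (slot fixed ∕ both legs; slot + first leg;
slot + second leg) are `HasSum … 0` — the comb twin of leaf-04 g63's `ThreeFaceRecClosed.hasSum_unitS_SpureRecAt`. -/
theorem hasSum_unitS_SpureCombOf (hLo : Odd Lc) (hLc3 : 3 ≤ Lc) (cΛt cE cVH cΛ : ℝ) (j : ℕ) (sf sm : ℝ) (κ a b : Fin (d + 1)) (s : Site (d + 1)) :
    HasSum (fun p : Site (d + 1) × Site (d + 1) =>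
        unitS sf sm (SpureCombOf (symTablesAn1S2 d Lc cΛt) cE cVH cΛ j) κ s p.1 p.2 (Sum.inl a) (Sum.inl b)) 0 ∧
      HasSum (fun p : Site (d + 1) × Site (d + 1) =>
        unitS sf sm (SpureCombOf (symTablesAn1S2 d Lc cΛt) cE cVH cΛ j) κ p.1 p.2 s (Sum.inl a) (Sum.inl b)) 0 ∧
      HasSum (fun p : Site (d + 1) × Site (d + 1) =>
        unitS sf sm (SpureCombOf (symTablesAn1S2 d Lc cΛt) cE cVH cΛ j) κ p.1 s p.2 (Sum.inl a) (Sum.inl b)) 0 := by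
  cases j with
  | zero => exact hasSum_unitS_SpureCombOf_zero cΛt cE cVH cΛ sf sm κ a b s
  | succ j =>
    exact ⟨hasSum_legs_unitS_SpureCombOf_succ hLo hLc3 cΛt sf sm cE cVH cΛ j κ s a b,
      hasSum_slot_leg_unitS_SpureCombOf_succ hLo hLc3 cΛt sf sm cE cVH cΛ j κ a b s,
      hasSum_slot_leg'_unitS_SpureCombOf_succ hLo hLc3 cΛt sf sm cE cVH cΛ j κ a b s⟩

end Summit.QuantumFields.BalabanUV.Beta.GAN24.CombSpureSlotCharges

end
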